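import Summits.QuantumFields.BalabanUV.Beta.GAN24.SlotDefectWindowLegShapes

/-!
# `BalabanUV.Beta.GAN24.DressingDefectOfDivergences` — binder row G-an2-4 ∕ (CONV-C), W-slot, the (α-0) parity re-cut's (α-END-b) ASSEMBLY STEP
# (the OWNER gan24-p1 g33's `ALPHA0-STATUS` v0.2 L8b «then ONE undressed step ⟹ `hcell` (cell = `𝒜^K((𝔇 − 1) y)`); (Q-L) enters here»; journal
# INTENT [LEAF03-G66-ONLINE] «DIVERGENCE LETTERS ⇒ CELL», FILE 1): **THE DRESSING DEFECT `𝔇 Y − Y` OF ANY TABLE IS `LocStencil₂` WITH A CONSTANT THAT IS A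
# WINDOW MULTIPLE OF THE FOUR SINGLE-DIVERGENCE LETTERS OF `Y`** — second source slot, first source slot, first kernel leg, second kernel leg — and of NOTHING
# ELSE: no mixed ∕ nested divergence, and NOT the table's own `LocStencil₂` constant.

NOT IN PRINT; OUR BOOKKEEPING (G-an2-4 crux team (2), leaf prover `b2b-balaban-gan24-formalise-leaf-03`, gen 66).  [folklore] finite-window bookkeeping BY NAME over
leaf-06 g43's T-DL (`TableDressingDefect.tableDress_sub_self`: `𝔇 − 1 = (P₂ − 1) + (P₁ − 1)P₂ + (L₁ − 1)P₁P₂ + (L₂ − 1)L₁P₁P₂`, FOUR terms), leaf-02 g53's ι-WIN window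
shapes (`SlotDefectWindowShapes.locStencil₂_coProj_snd ∕ fst_sub_self_of_div`, `SlotDefectWindowLegShapes.locStencil₂_legDefect₁ ∕ ₂_of_div`), leaf-06 g42's
`LinT2CoDressed.locStencil₂_coProj_snd ∕ _fst` and an2's `AxialDressingRooted.biLoc_legCo₁BmAt`.  Generic `d + 1`, generic blocking `N`, in-block root `ρ = toSite r`,
`1 ≤ N`, `0 ≤ δ`; the operators `P₂ P₁ L₁ L₂` and `𝔇 Y − Y` are written EXACTLY as the lambdas of leaf-06's `tableDress_eq_legs ∕ tableDress_sub_self`; the four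
letter tables are lambdas (0 `def`, 0 cited facts, 0 `def … : Prop`, 0 sorry).
HONEST FRAMING (cell contract, verbatim): «discharging `BetaPertH` makes Bałaban's UV stability UNCONDITIONAL — a real constructive-QFT result; it is NOT the
continuum limit and NOT the Clay problem.»  HONEST DEPENDENCY (verbatim): «continuum YM on T⁴ ⇐ BetaPertH ∧ nine spine estimates (0/9 proved); BetaPertH ⇐
(D1) ∧ (D4) ∧ CAP+tail; G-an2-4 gates asym, D1 and NE2/3/4.»

## The four letter tables (as `LocStencil₂` rows; each UNFOLDS to leaf-02's displayed letter verbatim)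
* `Λ₁ Y := fun _ p κ′ u′ ↦ divV (κ₁ u₁ ↦ Y κ₁ u₁ κ′ u′) p` — the FIRST-SOURCE-SLOT divergence at `p`, the second slot `(κ′, u′)` passive;
  `LocStencil₂ (Λ₁ Y) C δ` ⟺ `|(divV (κ₁ u₁ ↦ Y κ₁ u₁ κ′ u′) p) x z a b| ≤ C·e^{−δ|u′ − p|₁}·e^{−δ(|x − p|₁ + |z − p|₁)}` (the letter of `locStencil₂_coProj_fst_sub_self_of_div`).
* `Λ₂ Y := fun κ u _ p ↦ divV (κ₁ u₁ ↦ Y κ u κ₁ u₁) p` — the SECOND-SOURCE-SLOT divergence; `LocStencil₂ (Λ₂ Y) C δ` ⟺ the letter of `locStencil₂_coProj_snd_sub_self_of_div`.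
* `Λ_{L1} Y := fun κ u κ′ u′ ↦ (p z _ b ↦ Σ_β (Y κ u κ′ u′ p z (inl β) b − Y κ u κ′ u′ (p − e_β) z (inl β) b))` — the FIRST-KERNEL-LEG divergence; ⟺ the letter of `locStencil₂_legDefect₁_of_div`.
* `Λ_{L2} Y := fun κ u κ′ u′ ↦ (x p a _ ↦ Σ_β (Y κ u κ′ u′ x p a (inl β) − Y κ u κ′ u′ x (p − e_β) a (inl β)))` — the SECOND-KERNEL-LEG divergence; ⟺ the letter of `locStencil₂_legDefect₂_of_div`.

## What
* §1 COMMUTATIONS (finite sums on DISJOINT index groups; `coProjBmAt_finset_sum_sub` BY NAME): the first-slot divergence passes through `P₂` (`divV_fst_coProj_snd`), the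
  first-leg divergence through `P₂` and `P₁` (`legDiv₁_coProj_snd ∕ _fst`), the second-leg divergence through `P₂`, `P₁` and — on field rows — `L₁` (`legDiv₂_coProj_snd ∕ _fst`,
  `legDiv₂_legCo₁_inl ∕ _inr`).  (leaf-02's `SlotDefectWindowLegs` §2 has the same identities for the DEFECTS `P_s − 1`; here for the operators themselves.)
* §2 WINDOWS PRESERVE THE LETTER ROWS: `locStencil₂_legCo₁` (an2's `biLoc_legCo₁BmAt` as a `LocStencil₂` row, constant `cKb`); the transported letters
  `letter_fst_coProj_snd` (`Λ₁ (P₂ Y)`: constant `cKb·C₁`), `letter_leg₁_coProj_fst_snd` (`Λ_{L1} (P₁ P₂ Y)`: `cWb·e^{3δ(d+1)N}·(cKb·C_{L1})`),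
  `letter_leg₂_legCo₁_coProj_fst_snd` (`Λ_{L2} (L₁ P₁ P₂ Y)`: `cKb·(cWb·e^{3δ(d+1)N}·(cKb·C_{L2}))`) — each in leaf-02's displayed letter form, ready for its `…_of_div` lemma.
* §3 **`locStencil₂_tableDress_sub_self_of_divergences`** — THE END: the four letter rows on `Y` (constants `C₂ C₁ C_{L1} C_{L2}`, one rate `δ`) ⟹
  `LocStencil₂ (𝔇 Y − Y) (w·E₁·C₂ + w·E₃·(cKb·C₁) + w·E₁·(cWb·E₃·(cKb·C_{L1})) + w·E₁·(cKb·(cWb·E₃·(cKb·C_{L2})))) δ`, `w = 2(d+1)N·(2N+1)^{d+1}`, `E_k = e^{kδ(d+1)N}`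
  — A FUNCTION OF `(d, N, δ)` AND THE FOUR LETTER CONSTANTS ONLY (contrast: leaf-06's `locStencil₂_tableDress_sub_self` has constant `(κ_𝔇 + 1)·C_Y`, the table's OWN
  constant — the level accumulation the refuter's (B4) prices); **`locStencil₂_tableDress_sub_self_of_divergences_family`** — the same for a family `Y_l` with `l`-FREE letter
  constants, `∀ l`.
WHY (the (α-END)): the cell of the `ε`-member is `𝒜^K_l ((𝔇 − 1) y_l)` (leaf-06's `lin4_comb_coDressKBmAt_sub`); FILE 2 `HalfMemberCellOfDivergences` turns §3 into the `hcell` row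
of the OWNER's `T2ShapeEvenEndRows` from four letter rows on `y_l`; the two SLOT rows are (b1) (leaf-01 g72 `HalfMemberSlavedDivergence`) ∘ F4 ∘ S-rows data, the two LEG
rows are (Q-L) (row L11, RULING R-gan24p1-g33-2 (3)) in letter currency.
Asserts NO value of any divergence of Bałaban's tables; the letter rows are HYPOTHESES; discharges NOTHING of `hcell` ∕ (Q-L) ∕ (C) ∕ «T2Shape» ∕ «T2Drift» ∕ (hW, hWall);
0 wall binders; NEVER «G-an2-4 closed» as (CONV-C); NOT D1, NOT `BetaPertH`, NOT continuum, NOT Clay; not in print — our bookkeeping.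
Unit `b2b-balaban-gan24-formalise-leaf-03` (gen 66), 2026-08-23.
-/

noncomputable section

open Finset
open scoped BigOperators
open Literature.MathematicalPhysics.QuantumFieldTheory
open Literature.MathematicalPhysics.QuantumFieldTheory.Balaban1983to89
open Literature.MathematicalPhysics.QuantumFieldTheory.Balaban1983to89.Beta
open B12Sec2to5 (l1 l1_nonneg)
open ExpKernelCalculus (MKer Site BiLoc)
open AffineAveraging (Form0 Form1 box toSite unitVec)
open OneStepResolventKernel (Fib)
open KernelWard (divV)
open BalabanCompositeJets (LocStencil₂)
open Summit.QuantumFields.BalabanUV.Beta.AxialDressingRooted (cube cWb cWb_nonneg cKb cKb_nonneg coProjBmAt coProjBmAtK coProjBmAtK_eval dressKBmAt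
  legCo₁BmAt legCo₂BmAt legCo₁BmAt_inl legCo₁BmAt_inr biLoc_legCo₁BmAt)
open Summit.QuantumFields.BalabanUV.Beta.GAN24.BiStencilZeroMode (Tab)
open Summit.QuantumFields.BalabanUV.Beta.GAN24.LinT2CoDressed (locStencil₂_coProj_snd locStencil₂_coProj_fst)
open Summit.QuantumFields.BalabanUV.Beta.GAN24.TableDressingDefect (tableDress_sub_self)
open Summit.QuantumFields.BalabanUV.Beta.GAN24.SlotDefectWindowBound (coProjBmAt_finset_sum_sub divV_apply two_mul_nonneg)
open Summit.QuantumFields.BalabanUV.Beta.GAN24.SlotDefectWindowShapes (locStencil₂_coProj_fst_sub_self_of_div locStencil₂_coProj_snd_sub_self_of_div)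
open Summit.QuantumFields.BalabanUV.Beta.GAN24.SlotDefectWindowLegShapes (locStencil₂_legDefect₁_of_div locStencil₂_legDefect₂_of_div)

namespace Summit.QuantumFields.BalabanUV.Beta.GAN24.DressingDefectOfDivergences

variable {d : ℕ}

/-! ## §1 Commutations: a divergence in one variable passes through the window operator in another -/

section Commute

variable (ρ : Fin (d + 1) → ℤ) (N : ℕ)

/-- [folklore] **`Δ₁ ∘ P₂ = P₂ ∘ Δ₁`**: the first-slot divergence of the second-slot-dressed table is the window (in the second slot) of the first-slot divergence. -/
theorem divV_fst_coProj_snd (Y : Tab d) (p : Fin (d + 1) → ℤ) (κ' : Fin (d + 1)) (u' x z : Fin (d + 1) → ℤ) (a b : Fib d) :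
    divV (fun κ₁ u₁ => coProjBmAtK ρ N (Y κ₁ u₁) κ' u') p x z a b
      = coProjBmAt ρ N (fun κ₂ u₂ => divV (fun κ₁ u₁ => Y κ₁ u₁ κ₂ u₂) p x z a b) κ' u' := by
  have eG : (fun κ₂ u₂ => divV (fun κ₁ u₁ => Y κ₁ u₁ κ₂ u₂) p x z a b)
      = fun κ₂ u₂ => ∑ μ : Fin (d + 1), (Y μ (p - unitVec μ) κ₂ u₂ x z a b - Y μ p κ₂ u₂ x z a b) := by
    funext κ₂ u₂
    exact divV_apply _ p x z a b
  rw [eG, coProjBmAt_finset_sum_sub, divV_apply]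
  refine Finset.sum_congr rfl fun μ _ => ?_
  simp only [coProjBmAtK_eval]

/-- [folklore] **`∂_{L1} ∘ P₂ = P₂ ∘ ∂_{L1}`**: the first-leg divergence of the second-slot-dressed table. -/
theorem legDiv₁_coProj_snd (Y : Tab d) (κ : Fin (d + 1)) (u : Fin (d + 1) → ℤ) (κ' : Fin (d + 1)) (u' p z : Fin (d + 1) → ℤ) (b : Fib d) :
    ∑ β : Fin (d + 1), (coProjBmAtK ρ N (Y κ u) κ' u' p z (Sum.inl β) b - coProjBmAtK ρ N (Y κ u) κ' u' (p - unitVec β) z (Sum.inl β) b)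
      = coProjBmAt ρ N (fun κ₂ u₂ => ∑ β : Fin (d + 1), (Y κ u κ₂ u₂ p z (Sum.inl β) b - Y κ u κ₂ u₂ (p - unitVec β) z (Sum.inl β) b)) κ' u' := by
  rw [coProjBmAt_finset_sum_sub]
  refine Finset.sum_congr rfl fun β _ => ?_
  simp only [coProjBmAtK_eval]

/-- [folklore] **`∂_{L1} ∘ P₁ = P₁ ∘ ∂_{L1}`**: the first-leg divergence of the first-slot-dressed table. -/
theorem legDiv₁_coProj_fst (Y : Tab d) (κ : Fin (d + 1)) (u : Fin (d + 1) → ℤ) (κ' : Fin (d + 1)) (u' p z : Fin (d + 1) → ℤ) (b : Fib d) :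
    ∑ β : Fin (d + 1), (coProjBmAtK ρ N (fun κ₁ u₁ => Y κ₁ u₁ κ' u') κ u p z (Sum.inl β) b
        - coProjBmAtK ρ N (fun κ₁ u₁ => Y κ₁ u₁ κ' u') κ u (p - unitVec β) z (Sum.inl β) b)
      = coProjBmAt ρ N (fun κ₁ u₁ => ∑ β : Fin (d + 1), (Y κ₁ u₁ κ' u' p z (Sum.inl β) b - Y κ₁ u₁ κ' u' (p - unitVec β) z (Sum.inl β) b)) κ u := by
  rw [coProjBmAt_finset_sum_sub]
  refine Finset.sum_congr rfl fun β _ => ?_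
  simp only [coProjBmAtK_eval]

/-- [folklore] **`∂_{L2} ∘ P₂ = P₂ ∘ ∂_{L2}`**: the second-leg divergence of the second-slot-dressed table. -/
theorem legDiv₂_coProj_snd (Y : Tab d) (κ : Fin (d + 1)) (u : Fin (d + 1) → ℤ) (κ' : Fin (d + 1)) (u' x p : Fin (d + 1) → ℤ) (a : Fib d) :
    ∑ β : Fin (d + 1), (coProjBmAtK ρ N (Y κ u) κ' u' x p a (Sum.inl β) - coProjBmAtK ρ N (Y κ u) κ' u' x (p - unitVec β) a (Sum.inl β))
      = coProjBmAt ρ N (fun κ₂ u₂ => ∑ β : Fin (d + 1), (Y κ u κ₂ u₂ x p a (Sum.inl β) - Y κ u κ₂ u₂ x (p - unitVec β) a (Sum.inl β))) κ' u' := by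
  rw [coProjBmAt_finset_sum_sub]
  refine Finset.sum_congr rfl fun β _ => ?_
  simp only [coProjBmAtK_eval]

/-- [folklore] **`∂_{L2} ∘ P₁ = P₁ ∘ ∂_{L2}`**: the second-leg divergence of the first-slot-dressed table. -/
theorem legDiv₂_coProj_fst (Y : Tab d) (κ : Fin (d + 1)) (u : Fin (d + 1) → ℤ) (κ' : Fin (d + 1)) (u' x p : Fin (d + 1) → ℤ) (a : Fib d) :
    ∑ β : Fin (d + 1), (coProjBmAtK ρ N (fun κ₁ u₁ => Y κ₁ u₁ κ' u') κ u x p a (Sum.inl β)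
        - coProjBmAtK ρ N (fun κ₁ u₁ => Y κ₁ u₁ κ' u') κ u x (p - unitVec β) a (Sum.inl β))
      = coProjBmAt ρ N (fun κ₁ u₁ => ∑ β : Fin (d + 1), (Y κ₁ u₁ κ' u' x p a (Sum.inl β) - Y κ₁ u₁ κ' u' x (p - unitVec β) a (Sum.inl β))) κ u := by
  rw [coProjBmAt_finset_sum_sub]
  refine Finset.sum_congr rfl fun β _ => ?_
  simp only [coProjBmAtK_eval]

/-- [folklore] **`∂_{L2} ∘ L₁ = L₁ ∘ ∂_{L2}` ON FIELD ROWS** (the first-leg window acts on `(α, x)`, the divergence on the second leg `(p, inl β)`). -/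
theorem legDiv₂_legCo₁_inl (V : MKer (d + 1) (Fib d)) (x p : Fin (d + 1) → ℤ) (α : Fin (d + 1)) :
    ∑ β : Fin (d + 1), (legCo₁BmAt ρ N V x p (Sum.inl α) (Sum.inl β) - legCo₁BmAt ρ N V x (p - unitVec β) (Sum.inl α) (Sum.inl β))
      = coProjBmAt ρ N (fun α' x' => ∑ β : Fin (d + 1), (V x' p (Sum.inl α') (Sum.inl β) - V x' (p - unitVec β) (Sum.inl α') (Sum.inl β))) α x := by
  rw [coProjBmAt_finset_sum_sub]
  refine Finset.sum_congr rfl fun β _ => ?_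
  simp only [legCo₁BmAt_inl]

/-- [folklore] `∂_{L2} ∘ L₁ = ∂_{L2}` on multiplier rows (the first-leg window leaves them untouched). -/
theorem legDiv₂_legCo₁_inr (V : MKer (d + 1) (Fib d)) (x p : Fin (d + 1) → ℤ) (m : Fin (d + 1)) :
    ∑ β : Fin (d + 1), (legCo₁BmAt ρ N V x p (Sum.inr m) (Sum.inl β) - legCo₁BmAt ρ N V x (p - unitVec β) (Sum.inr m) (Sum.inl β))
      = ∑ β : Fin (d + 1), (V x p (Sum.inr m) (Sum.inl β) - V x (p - unitVec β) (Sum.inr m) (Sum.inl β)) := by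
  refine Finset.sum_congr rfl fun β _ => ?_
  simp only [legCo₁BmAt_inr]

end Commute

/-! ## §2 The windows preserve the letter rows -/

section Transport

variable {N : ℕ} {r : Fin (d + 1) → ℕ}

/-- [folklore] **THE FIRST-LEG WINDOW PRESERVES `LocStencil₂`** (an2's `biLoc_legCo₁BmAt` row by row; in-block root, `1 ≤ N`, `0 ≤ δ`, constant `cKb`). -/
theorem locStencil₂_legCo₁ (hN : 1 ≤ N) (hr : r ∈ box (d + 1) N) {T : Tab d} {C δ : ℝ} (hT : LocStencil₂ T C δ) (hδ : 0 ≤ δ) :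
    LocStencil₂ (fun κ u κ' u' => legCo₁BmAt (toSite r) N (T κ u κ' u')) (cKb d N δ * C) δ := by
  intro κ u κ' u'
  have h := biLoc_legCo₁BmAt hN hr (hT κ u κ' u') hδ
  have e : cKb d N δ * (C * Real.exp (-δ * l1 (u' - u))) = cKb d N δ * C * Real.exp (-δ * l1 (u' - u)) := by ring
  rw [e] at h
  exact h

/-- NOT IN PRINT; OUR BOOKKEEPING.  **THE FIRST-SLOT LETTER OF `P₂ Y` FROM THE FIRST-SLOT LETTER OF `Y`** (constant `cKb·C₁`; §1 `divV_fst_coProj_snd` + leaf-06's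
`locStencil₂_coProj_snd` on the letter table `Λ₁ Y`), in leaf-02's displayed letter form for `locStencil₂_coProj_fst_sub_self_of_div` at `P₂ Y`. -/
theorem letter_fst_coProj_snd (hN : 1 ≤ N) (hr : r ∈ box (d + 1) N) (Y : Tab d) {C₁ δ : ℝ} (hδ : 0 ≤ δ)
    (h₁ : LocStencil₂ (fun (_ : Fin (d + 1)) (p : Fin (d + 1) → ℤ) (κ' : Fin (d + 1)) (u' : Fin (d + 1) → ℤ) =>
      divV (fun κ₁ u₁ => Y κ₁ u₁ κ' u') p) C₁ δ) :
    ∀ (p : Fin (d + 1) → ℤ) (κ' : Fin (d + 1)) (u' x z : Fin (d + 1) → ℤ) (a b : Fib d),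
      |divV (fun κ₁ u₁ => (fun κ u => coProjBmAtK (toSite r) N (Y κ u)) κ₁ u₁ κ' u') p x z a b|
        ≤ cKb d N δ * C₁ * Real.exp (-δ * l1 (u' - p)) * Real.exp (-δ * (l1 (x - p) + l1 (z - p))) := by
  have hT := locStencil₂_coProj_snd hN hr h₁ hδ
  intro p κ' u' x z a b
  have h := hT 0 p κ' u' x z a b
  dsimp only at h
  rw [coProjBmAtK_eval] at h
  show |divV (fun κ₁ u₁ => coProjBmAtK (toSite r) N (Y κ₁ u₁) κ' u') p x z a b| ≤ _
  rw [divV_fst_coProj_snd]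
  exact h

/-- NOT IN PRINT; OUR BOOKKEEPING.  **THE FIRST-LEG LETTER OF `P₁ P₂ Y` FROM THE FIRST-LEG LETTER OF `Y`** (constant `cWb·e^{3δ(d+1)N}·(cKb·C_{L1})`; §1
`legDiv₁_coProj_fst ∕ _snd` + leaf-06's `locStencil₂_coProj_fst ∘ locStencil₂_coProj_snd` on the letter table `Λ_{L1} Y`), in the displayed letter form for
`locStencil₂_legDefect₁_of_div` at `P₁ P₂ Y`. -/
theorem letter_leg₁_coProj_fst_snd (hN : 1 ≤ N) (hr : r ∈ box (d + 1) N) (Y : Tab d) {C δ : ℝ} (hδ : 0 ≤ δ)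
    (hL : LocStencil₂ (fun κ u κ' u' => fun (p z : Fin (d + 1) → ℤ) (_ : Fib d) (b : Fib d) =>
      ∑ β : Fin (d + 1), (Y κ u κ' u' p z (Sum.inl β) b - Y κ u κ' u' (p - unitVec β) z (Sum.inl β) b)) C δ) :
    ∀ (κ : Fin (d + 1)) (u : Fin (d + 1) → ℤ) (κ' : Fin (d + 1)) (u' p z : Fin (d + 1) → ℤ) (b : Fib d),
      |∑ β : Fin (d + 1),
          ((fun κ u κ' u' => coProjBmAtK (toSite r) N (fun κ₁ u₁ => coProjBmAtK (toSite r) N (Y κ₁ u₁) κ' u') κ u) κ u κ' u' p z (Sum.inl β) b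
            - (fun κ u κ' u' => coProjBmAtK (toSite r) N (fun κ₁ u₁ => coProjBmAtK (toSite r) N (Y κ₁ u₁) κ' u') κ u) κ u κ' u' (p - unitVec β) z
                (Sum.inl β) b)|
        ≤ cWb d N * Real.exp (3 * δ * (((d : ℝ) + 1) * N)) * (cKb d N δ * C) * Real.exp (-δ * l1 (u' - u))
            * Real.exp (-δ * (l1 (p - u) + l1 (z - u))) := by
  have hT := locStencil₂_coProj_fst hN hr (locStencil₂_coProj_snd hN hr hL hδ) hδ
  intro κ u κ' u' p z b
  have h := hT κ u κ' u' p z (Sum.inl 0) b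
  dsimp only at h
  rw [coProjBmAtK_eval] at h
  simp only [coProjBmAtK_eval] at h
  show |∑ β : Fin (d + 1), (coProjBmAtK (toSite r) N (fun κ₁ u₁ => coProjBmAtK (toSite r) N (Y κ₁ u₁) κ' u') κ u p z (Sum.inl β) b
      - coProjBmAtK (toSite r) N (fun κ₁ u₁ => coProjBmAtK (toSite r) N (Y κ₁ u₁) κ' u') κ u (p - unitVec β) z (Sum.inl β) b)| ≤ _
  rw [legDiv₁_coProj_fst]
  have e : (fun κ₁ u₁ => ∑ β : Fin (d + 1), (coProjBmAtK (toSite r) N (Y κ₁ u₁) κ' u' p z (Sum.inl β) b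
      - coProjBmAtK (toSite r) N (Y κ₁ u₁) κ' u' (p - unitVec β) z (Sum.inl β) b))
      = fun κ₁ u₁ => coProjBmAt (toSite r) N (fun κ₂ u₂ => ∑ β : Fin (d + 1),
          (Y κ₁ u₁ κ₂ u₂ p z (Sum.inl β) b - Y κ₁ u₁ κ₂ u₂ (p - unitVec β) z (Sum.inl β) b)) κ' u' := by
    funext κ₁ u₁
    exact legDiv₁_coProj_snd (toSite r) N Y κ₁ u₁ κ' u' p z b
  rw [e]
  exact h

/-- NOT IN PRINT; OUR BOOKKEEPING.  **THE SECOND-LEG LETTER OF `L₁ P₁ P₂ Y` FROM THE SECOND-LEG LETTER OF `Y`** (constant `cKb·(cWb·e^{3δ(d+1)N}·(cKb·C_{L2}))`; §1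
`legDiv₂_legCo₁_inl ∕ _inr`, `legDiv₂_coProj_fst ∕ _snd` + `locStencil₂_legCo₁ ∘ locStencil₂_coProj_fst ∘ locStencil₂_coProj_snd` on the letter table `Λ_{L2} Y`), in the
displayed letter form for `locStencil₂_legDefect₂_of_div` at `L₁ P₁ P₂ Y`. -/
theorem letter_leg₂_legCo₁_coProj_fst_snd (hN : 1 ≤ N) (hr : r ∈ box (d + 1) N) (Y : Tab d) {C δ : ℝ} (hδ : 0 ≤ δ)
    (hL : LocStencil₂ (fun κ u κ' u' => fun (x p : Fin (d + 1) → ℤ) (a : Fib d) (_ : Fib d) =>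
      ∑ β : Fin (d + 1), (Y κ u κ' u' x p a (Sum.inl β) - Y κ u κ' u' x (p - unitVec β) a (Sum.inl β))) C δ) :
    ∀ (κ : Fin (d + 1)) (u : Fin (d + 1) → ℤ) (κ' : Fin (d + 1)) (u' x p : Fin (d + 1) → ℤ) (a : Fib d),
      |∑ β : Fin (d + 1),
          ((fun κ u κ' u' => legCo₁BmAt (toSite r) N
              (coProjBmAtK (toSite r) N (fun κ₁ u₁ => coProjBmAtK (toSite r) N (Y κ₁ u₁) κ' u') κ u)) κ u κ' u' x p a (Sum.inl β)
            - (fun κ u κ' u' => legCo₁BmAt (toSite r) N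
              (coProjBmAtK (toSite r) N (fun κ₁ u₁ => coProjBmAtK (toSite r) N (Y κ₁ u₁) κ' u') κ u)) κ u κ' u' x (p - unitVec β) a (Sum.inl β))|
        ≤ cKb d N δ * (cWb d N * Real.exp (3 * δ * (((d : ℝ) + 1) * N)) * (cKb d N δ * C)) * Real.exp (-δ * l1 (u' - u))
            * Real.exp (-δ * (l1 (x - u) + l1 (p - u))) := by
  have hT := locStencil₂_legCo₁ hN hr (locStencil₂_coProj_fst hN hr (locStencil₂_coProj_snd hN hr hL hδ) hδ) hδ
  intro κ u κ' u' x p a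
  have h := hT κ u κ' u' x p a (Sum.inl 0)
  dsimp only at h
  -- the two slot windows pushed through the second-leg divergence, at any first-leg point `(x', a')`
  have e2 : ∀ (x' : Fin (d + 1) → ℤ) (a' : Fib d),
      ∑ β : Fin (d + 1), (coProjBmAtK (toSite r) N (fun κ₁ u₁ => coProjBmAtK (toSite r) N (Y κ₁ u₁) κ' u') κ u x' p a' (Sum.inl β)
        - coProjBmAtK (toSite r) N (fun κ₁ u₁ => coProjBmAtK (toSite r) N (Y κ₁ u₁) κ' u') κ u x' (p - unitVec β) a' (Sum.inl β))
      = coProjBmAt (toSite r) N (fun κ₁ u₁ => coProjBmAt (toSite r) N (fun κ₂ u₂ => ∑ β : Fin (d + 1),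
          (Y κ₁ u₁ κ₂ u₂ x' p a' (Sum.inl β) - Y κ₁ u₁ κ₂ u₂ x' (p - unitVec β) a' (Sum.inl β))) κ' u') κ u := by
    intro x' a'
    rw [legDiv₂_coProj_fst]
    congr 1
    funext κ₁ u₁
    exact legDiv₂_coProj_snd (toSite r) N Y κ₁ u₁ κ' u' x' p a'
  show |∑ β : Fin (d + 1), (legCo₁BmAt (toSite r) N
      (coProjBmAtK (toSite r) N (fun κ₁ u₁ => coProjBmAtK (toSite r) N (Y κ₁ u₁) κ' u') κ u) x p a (Sum.inl β)
    - legCo₁BmAt (toSite r) N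
      (coProjBmAtK (toSite r) N (fun κ₁ u₁ => coProjBmAtK (toSite r) N (Y κ₁ u₁) κ' u') κ u) x (p - unitVec β) a (Sum.inl β))| ≤ _
  cases a with
  | inl α =>
    rw [legDiv₂_legCo₁_inl]
    have e3 : (fun α' x' => ∑ β : Fin (d + 1), (coProjBmAtK (toSite r) N (fun κ₁ u₁ => coProjBmAtK (toSite r) N (Y κ₁ u₁) κ' u') κ u x' p
        (Sum.inl α') (Sum.inl β)
        - coProjBmAtK (toSite r) N (fun κ₁ u₁ => coProjBmAtK (toSite r) N (Y κ₁ u₁) κ' u') κ u x' (p - unitVec β) (Sum.inl α') (Sum.inl β)))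
        = fun α' x' => coProjBmAt (toSite r) N (fun κ₁ u₁ => coProjBmAt (toSite r) N (fun κ₂ u₂ => ∑ β : Fin (d + 1),
          (Y κ₁ u₁ κ₂ u₂ x' p (Sum.inl α') (Sum.inl β) - Y κ₁ u₁ κ₂ u₂ x' (p - unitVec β) (Sum.inl α') (Sum.inl β))) κ' u') κ u := by
      funext α' x'
      exact e2 x' (Sum.inl α')
    rw [e3]
    rw [legCo₁BmAt_inl] at h
    simp only [coProjBmAtK_eval] at h
    exact h
  | inr m =>
    rw [legDiv₂_legCo₁_inr, e2 x (Sum.inr m)]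
    rw [legCo₁BmAt_inr] at h
    simp only [coProjBmAtK_eval] at h
    exact h

end Transport

/-! ## §3 The END: the dressing defect of a table is `LocStencil₂` by the four single-divergence letters of the table -/

section DefectEnd

variable {N : ℕ} {r : Fin (d + 1) → ℕ}

/-- [folklore] Sum of four `LocStencil₂` tables at a common rate (pointwise `+`; constants add). -/
theorem locStencil₂_add₄ {A B E F : Tab d} {CA CB CE CF δ : ℝ} (hA : LocStencil₂ A CA δ) (hB : LocStencil₂ B CB δ) (hE : LocStencil₂ E CE δ)
    (hF : LocStencil₂ F CF δ) : LocStencil₂ (A + B + E + F) (CA + CB + CE + CF) δ := by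
  intro κ u κ' u' x z a b
  have h1 := hA κ u κ' u' x z a b
  have h2 := hB κ u κ' u' x z a b
  have h3 := hE κ u κ' u' x z a b
  have h4 := hF κ u κ' u' x z a b
  show |A κ u κ' u' x z a b + B κ u κ' u' x z a b + E κ u κ' u' x z a b + F κ u κ' u' x z a b| ≤ _
  rw [add_mul, add_mul, add_mul, add_mul, add_mul, add_mul]
  exact (abs_add_le _ _).trans (add_le_add ((abs_add_three _ _ _).trans (add_le_add (add_le_add h1 h2) h3)) h4)

/-- NOT IN PRINT; OUR BOOKKEEPING.  **THE DRESSING DEFECT OF A TABLE IS `LocStencil₂` BY ITS FOUR SINGLE-DIVERGENCE LETTERS** (generic `d`, generic `N`,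
in-block root `ρ = toSite r`, `1 ≤ N`, `0 ≤ δ`, ANY table `Y`): if the second-source-slot, first-source-slot, first-kernel-leg and second-kernel-leg divergences of `Y`
carry the letter rows `LocStencil₂ (Λ₂ Y) C₂ δ`, `LocStencil₂ (Λ₁ Y) C₁ δ`, `LocStencil₂ (Λ_{L1} Y) C_{L1} δ`, `LocStencil₂ (Λ_{L2} Y) C_{L2} δ`, then leaf-06's dressing defect
`𝔇 Y − Y` (T-DL, literal spelling of `TableDressingDefect.tableDress_sub_self`) is `LocStencil₂` at rate `δ` with constant
`w·E₁·C₂ + w·E₃·(cKb·C₁) + w·E₁·(cWb·E₃·(cKb·C_{L1})) + w·E₁·(cKb·(cWb·E₃·(cKb·C_{L2})))`, `w = 2(d+1)N·(2N+1)^{d+1}`, `E_k = e^{kδ(d+1)N}` — a function of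
`(d, N, δ)` and the four letter constants ONLY (NOT of `Y`'s own `LocStencil₂` constant).  Route: the FOUR-TERM telescoping `tableDress_sub_self`; term by term leaf-02's
`locStencil₂_coProj_snd_sub_self_of_div` (on `Y`), `locStencil₂_coProj_fst_sub_self_of_div` (on `P₂ Y`, letter §2 `letter_fst_coProj_snd`), `locStencil₂_legDefect₁_of_div`
(on `P₁ P₂ Y`, `letter_leg₁_coProj_fst_snd`), `locStencil₂_legDefect₂_of_div` (on `L₁ P₁ P₂ Y`, `letter_leg₂_legCo₁_coProj_fst_snd`); `locStencil₂_add₄`.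
The letter rows are HYPOTHESES; nothing of (b1) ∕ (Q-L) is proved here. -/
theorem locStencil₂_tableDress_sub_self_of_divergences (hN : 1 ≤ N) (hr : r ∈ box (d + 1) N) (Y : Tab d) {C₂ C₁ CL₁ CL₂ δ : ℝ} (hδ : 0 ≤ δ)
    (h₂ : LocStencil₂ (fun (κ : Fin (d + 1)) (u : Fin (d + 1) → ℤ) (_ : Fin (d + 1)) (p : Fin (d + 1) → ℤ) =>
      divV (fun κ₁ u₁ => Y κ u κ₁ u₁) p) C₂ δ)
    (h₁ : LocStencil₂ (fun (_ : Fin (d + 1)) (p : Fin (d + 1) → ℤ) (κ' : Fin (d + 1)) (u' : Fin (d + 1) → ℤ) =>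
      divV (fun κ₁ u₁ => Y κ₁ u₁ κ' u') p) C₁ δ)
    (hL₁ : LocStencil₂ (fun κ u κ' u' => fun (p z : Fin (d + 1) → ℤ) (_ : Fib d) (b : Fib d) =>
      ∑ β : Fin (d + 1), (Y κ u κ' u' p z (Sum.inl β) b - Y κ u κ' u' (p - unitVec β) z (Sum.inl β) b)) CL₁ δ)
    (hL₂ : LocStencil₂ (fun κ u κ' u' => fun (x p : Fin (d + 1) → ℤ) (a : Fib d) (_ : Fib d) =>
      ∑ β : Fin (d + 1), (Y κ u κ' u' x p a (Sum.inl β) - Y κ u κ' u' x (p - unitVec β) a (Sum.inl β))) CL₂ δ) :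
    LocStencil₂ ((fun κ u κ' u' => dressKBmAt (toSite r) N (coProjBmAtK (toSite r) N (fun κ₁ u₁ => coProjBmAtK (toSite r) N (Y κ₁ u₁) κ' u') κ u)) - Y)
      (2 * ((d : ℝ) + 1) * N * ((((2 * N + 1) ^ (d + 1) : ℕ) : ℝ) * (Real.exp (δ * (((d : ℝ) + 1) * N)) * C₂))
        + 2 * ((d : ℝ) + 1) * N * ((((2 * N + 1) ^ (d + 1) : ℕ) : ℝ) * (Real.exp (3 * δ * (((d : ℝ) + 1) * N)) * (cKb d N δ * C₁)))
        + 2 * ((d : ℝ) + 1) * N * ((((2 * N + 1) ^ (d + 1) : ℕ) : ℝ)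
            * (Real.exp (δ * (((d : ℝ) + 1) * N)) * (cWb d N * Real.exp (3 * δ * (((d : ℝ) + 1) * N)) * (cKb d N δ * CL₁))))
        + 2 * ((d : ℝ) + 1) * N * ((((2 * N + 1) ^ (d + 1) : ℕ) : ℝ)
            * (Real.exp (δ * (((d : ℝ) + 1) * N)) * (cKb d N δ * (cWb d N * Real.exp (3 * δ * (((d : ℝ) + 1) * N)) * (cKb d N δ * CL₂))))))
      δ := by
  have t1 := locStencil₂_coProj_snd_sub_self_of_div hN hr Y hδ (fun κ u p x z a b => h₂ κ u 0 p x z a b)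
  have t2 := locStencil₂_coProj_fst_sub_self_of_div hN hr (fun κ u => coProjBmAtK (toSite r) N (Y κ u)) hδ
    (letter_fst_coProj_snd hN hr Y hδ h₁)
  have t3 := locStencil₂_legDefect₁_of_div hN hr
    (fun κ u κ' u' => coProjBmAtK (toSite r) N (fun κ₁ u₁ => coProjBmAtK (toSite r) N (Y κ₁ u₁) κ' u') κ u) hδ
    (letter_leg₁_coProj_fst_snd hN hr Y hδ hL₁)
  have t4 := locStencil₂_legDefect₂_of_div hN hr
    (fun κ u κ' u' => legCo₁BmAt (toSite r) N (coProjBmAtK (toSite r) N (fun κ₁ u₁ => coProjBmAtK (toSite r) N (Y κ₁ u₁) κ' u') κ u)) hδ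
    (letter_leg₂_legCo₁_coProj_fst_snd hN hr Y hδ hL₂)
  rw [tableDress_sub_self]
  exact locStencil₂_add₄ t1 t2 t3 t4

/-- NOT IN PRINT; OUR BOOKKEEPING.  **FAMILY FORM — LEVEL-FREE LETTERS GIVE A LEVEL-FREE DEFECT CONSTANT**: if every member `Y_l` of a family of tables carries the four
letter rows with the SAME constants `C₂ C₁ C_{L1} C_{L2}` at one rate `δ`, then every `𝔇 Y_l − Y_l` is `LocStencil₂` with the ONE constant of
`locStencil₂_tableDress_sub_self_of_divergences` — the shape the (α-END)'s `hcell` row wants (FILE 2 `HalfMemberCellOfDivergences`). -/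
theorem locStencil₂_tableDress_sub_self_of_divergences_family (hN : 1 ≤ N) (hr : r ∈ box (d + 1) N) (Y : ℕ → Tab d) {C₂ C₁ CL₁ CL₂ δ : ℝ}
    (hδ : 0 ≤ δ)
    (h₂ : ∀ l, LocStencil₂ (fun (κ : Fin (d + 1)) (u : Fin (d + 1) → ℤ) (_ : Fin (d + 1)) (p : Fin (d + 1) → ℤ) =>
      divV (fun κ₁ u₁ => Y l κ u κ₁ u₁) p) C₂ δ)
    (h₁ : ∀ l, LocStencil₂ (fun (_ : Fin (d + 1)) (p : Fin (d + 1) → ℤ) (κ' : Fin (d + 1)) (u' : Fin (d + 1) → ℤ) =>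
      divV (fun κ₁ u₁ => Y l κ₁ u₁ κ' u') p) C₁ δ)
    (hL₁ : ∀ l, LocStencil₂ (fun κ u κ' u' => fun (p z : Fin (d + 1) → ℤ) (_ : Fib d) (b : Fib d) =>
      ∑ β : Fin (d + 1), (Y l κ u κ' u' p z (Sum.inl β) b - Y l κ u κ' u' (p - unitVec β) z (Sum.inl β) b)) CL₁ δ)
    (hL₂ : ∀ l, LocStencil₂ (fun κ u κ' u' => fun (x p : Fin (d + 1) → ℤ) (a : Fib d) (_ : Fib d) =>
      ∑ β : Fin (d + 1), (Y l κ u κ' u' x p a (Sum.inl β) - Y l κ u κ' u' x (p - unitVec β) a (Sum.inl β))) CL₂ δ) :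
    ∀ l, LocStencil₂ ((fun κ u κ' u' => dressKBmAt (toSite r) N
        (coProjBmAtK (toSite r) N (fun κ₁ u₁ => coProjBmAtK (toSite r) N (Y l κ₁ u₁) κ' u') κ u)) - Y l)
      (2 * ((d : ℝ) + 1) * N * ((((2 * N + 1) ^ (d + 1) : ℕ) : ℝ) * (Real.exp (δ * (((d : ℝ) + 1) * N)) * C₂))
        + 2 * ((d : ℝ) + 1) * N * ((((2 * N + 1) ^ (d + 1) : ℕ) : ℝ) * (Real.exp (3 * δ * (((d : ℝ) + 1) * N)) * (cKb d N δ * C₁)))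
        + 2 * ((d : ℝ) + 1) * N * ((((2 * N + 1) ^ (d + 1) : ℕ) : ℝ)
            * (Real.exp (δ * (((d : ℝ) + 1) * N)) * (cWb d N * Real.exp (3 * δ * (((d : ℝ) + 1) * N)) * (cKb d N δ * CL₁))))
        + 2 * ((d : ℝ) + 1) * N * ((((2 * N + 1) ^ (d + 1) : ℕ) : ℝ)
            * (Real.exp (δ * (((d : ℝ) + 1) * N)) * (cKb d N δ * (cWb d N * Real.exp (3 * δ * (((d : ℝ) + 1) * N)) * (cKb d N δ * CL₂))))))
      δ :=
  fun l => locStencil₂_tableDress_sub_self_of_divergences hN hr (Y l) hδ (h₂ l) (h₁ l) (hL₁ l) (hL₂ l)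

/-- [folklore] The END's constant is nonnegative as soon as the four letter constants are (`0 ≤ δ` not even needed). -/
theorem defectConst_nonneg (d N : ℕ) (δ : ℝ) {C₂ C₁ CL₁ CL₂ : ℝ} (h₂ : 0 ≤ C₂) (h₁ : 0 ≤ C₁) (hL₁ : 0 ≤ CL₁) (hL₂ : 0 ≤ CL₂) :
    0 ≤ 2 * ((d : ℝ) + 1) * N * ((((2 * N + 1) ^ (d + 1) : ℕ) : ℝ) * (Real.exp (δ * (((d : ℝ) + 1) * N)) * C₂))
        + 2 * ((d : ℝ) + 1) * N * ((((2 * N + 1) ^ (d + 1) : ℕ) : ℝ) * (Real.exp (3 * δ * (((d : ℝ) + 1) * N)) * (cKb d N δ * C₁)))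
        + 2 * ((d : ℝ) + 1) * N * ((((2 * N + 1) ^ (d + 1) : ℕ) : ℝ)
            * (Real.exp (δ * (((d : ℝ) + 1) * N)) * (cWb d N * Real.exp (3 * δ * (((d : ℝ) + 1) * N)) * (cKb d N δ * CL₁))))
        + 2 * ((d : ℝ) + 1) * N * ((((2 * N + 1) ^ (d + 1) : ℕ) : ℝ)
            * (Real.exp (δ * (((d : ℝ) + 1) * N)) * (cKb d N δ * (cWb d N * Real.exp (3 * δ * (((d : ℝ) + 1) * N)) * (cKb d N δ * CL₂))))) := by
  have hw : (0 : ℝ) ≤ 2 * ((d : ℝ) + 1) * N := two_mul_nonneg d N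
  have hK : 0 ≤ cKb d N δ := cKb_nonneg d N δ
  have hW : 0 ≤ cWb d N := cWb_nonneg d N
  positivity

end DefectEnd


end Summit.QuantumFields.BalabanUV.Beta.GAN24.DressingDefectOfDivergences

end
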